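import Summits.Parity.BatemanHorn.Theorems.SoloInformedUpperBoundSieve
import Summits.Parity.BatemanHorn.Theorems.SoloInformedLargeDivisorTiers

/-!
# The unconditional window for the large-divisor Möbius–log sum of `n² + 1`

Solo unit `solo-Parity-informed` (ideation tier, informed mode), session 10; `PLAN.md` §18, CLAIMS C45.

Notation (informal): `ψ(N) = ∑_{n ≤ N} Λ(n²+1)`, `𝔖 = hardyLittlewoodEConst`, and for `0 < ε < 1`
`T(N) = ∑_{n ≤ N} ∑_{d ∣ n²+1, d > ⌊N^{1-ε}⌋} μ(d) log d`. From the sieve upper bound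
`π_E(N) ≤ (2𝔖 + o(1)) N/log N` (`SoloInformedUpperBoundSieve`) and the identity `ψ = 𝔖 N + E - T`,
`E = o(N)` (`SoloInformedLargeDivisorTiers`):

* `eventually_sum_vonMangoldt_sq_add_one_le` — `ψ(N) ≤ (4𝔖 + δ) N` eventually;
* `eventually_neg_le_largeDivisorSum` — `-(3𝔖 + δ) N ≤ T(N)` eventually;
* `eventually_largeDivisorSum_mem_window` — `-(3𝔖 + δ) N ≤ T(N) ≤ (𝔖 + δ) N` eventually.

So the unconditional window for `T` is `[-(3𝔖 + o(1)) N, (𝔖 + o(1)) N]`, NOT symmetric about `0`: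
the level available for `n² + 1` is `N^{1-ε} = X^{(1-ε)/2}` in terms of the size `X = N²` of the
members, where the linear sieve loses the factor `4` against Conjecture E, not the
factor `2` of Bombieri's asymptotic sieve (which would need signed level `X^{1-ε} = N^{2-2ε}`).
Conjecture E pins `T = o(N)` (`hardyLittlewoodConjE_iff_largeDivisorSum_twoSided`); Landau's
conjecture already follows from `T ≤ (𝔖 - c) N` infinitely often
(`landauConjecture_of_frequently_largeDivisorSum_le`); no constant strictly inside either wall is known.

References: H. Halberstam, H.-E. Richert, *Sieve Methods* (Academic Press 1974) Thm 5.3;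
H. Iwaniec, Invent. Math. 47 (1978) 171–188 [IwaniecInventiones1978]; E. Bombieri, *The asymptotic
sieve*, Rend. Accad. Naz. XL (5) 1/2 (1975/76) 243–269.
-/

namespace Summit.Parity.BatemanHorn.Theorems

open Finset Filter ArithmeticFunction Asymptotics
open scoped ArithmeticFunction.Moebius Topology
open Literature.NumberTheory.Sieve (hardyLittlewoodEConst hardyLittlewoodEConst_pos
  nSqAddOnePrimeCount)

/-- **`ψ(N) = ∑_{n ≤ N} Λ(n²+1) ≤ (4𝔖 + δ) N` eventually**, from `π_E(N) ≤ (2𝔖 + o(1)) N/log N`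
through `θ ≤ π_E · log(N²+1)` and `ψ - θ = o(N)` (`SoloInformedProperPrimePowers`). -/
theorem eventually_sum_vonMangoldt_sq_add_one_le {δ : ℝ} (hδ : 0 < δ) :
    ∀ᶠ N : ℕ in atTop, ∑ n ∈ Icc 1 N, Λ (n ^ 2 + 1) ≤ (4 * hardyLittlewoodEConst + δ) * N := by
  have hS := hardyLittlewoodEConst_pos
  have hδ8 : (0 : ℝ) < δ / 8 := by positivity
  have hlogbig : ∀ᶠ N : ℕ in atTop, (2 * hardyLittlewoodEConst + δ / 8) * 8 / δ ≤ Real.log N :=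
    (Real.tendsto_log_atTop.comp tendsto_natCast_atTop_atTop).eventually_ge_atTop _
  filter_upwards [eventually_nSqAddOnePrimeCount_le hδ8, eventually_properPrimePow_sum_le hδ8,
    hlogbig, eventually_ge_atTop 2] with N hπ hPP hlogN hN2
  have hN : (2 : ℝ) ≤ N := by exact_mod_cast hN2
  have hlog0 : 0 < Real.log N := Real.log_pos (by linarith)
  rw [sum_vonMangoldt_eq_theta_add]
  have hl2 : Real.log ((N : ℝ) ^ 2 + 1) ≤ 2 * Real.log N + 1 := log_sq_add_one_le (by linarith)
  have hπ' : (nSqAddOnePrimeCount N : ℝ) * Real.log N ≤ (2 * hardyLittlewoodEConst + δ / 8) * N :=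
    (le_div_iff₀ hlog0).mp hπ
  have hπ0 : (0 : ℝ) ≤ nSqAddOnePrimeCount N := Nat.cast_nonneg _
  have hπ1 : (nSqAddOnePrimeCount N : ℝ) ≤ δ / 8 * N := by
    have h1 : (nSqAddOnePrimeCount N : ℝ) * Real.log N ≤ (δ / 8 * N) * Real.log N :=
      calc (nSqAddOnePrimeCount N : ℝ) * Real.log N
          ≤ (2 * hardyLittlewoodEConst + δ / 8) * N := hπ'
        _ = (δ / 8 * N) * ((2 * hardyLittlewoodEConst + δ / 8) * 8 / δ) := by
            field_simp
        _ ≤ (δ / 8 * N) * Real.log N := by gcongr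
    exact le_of_mul_le_mul_right h1 hlog0
  have hθ' : ∑ n ∈ (Icc 1 N).filter (fun n : ℕ => Nat.Prime (n ^ 2 + 1)),
        Real.log ((n ^ 2 + 1 : ℕ) : ℝ)
      ≤ 2 * ((2 * hardyLittlewoodEConst + δ / 8) * N) + δ / 8 * N :=
    calc _ ≤ (nSqAddOnePrimeCount N : ℝ) * Real.log ((N : ℝ) ^ 2 + 1) := theta_le_card_mul_log N
      _ ≤ (nSqAddOnePrimeCount N : ℝ) * (2 * Real.log N + 1) := mul_le_mul_of_nonneg_left hl2 hπ0
      _ = 2 * ((nSqAddOnePrimeCount N : ℝ) * Real.log N) + nSqAddOnePrimeCount N := by ring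
      _ ≤ 2 * ((2 * hardyLittlewoodEConst + δ / 8) * N) + δ / 8 * N := by gcongr
  have : 0 ≤ δ * N := by positivity
  linarith

/-- **`-(3𝔖 + δ) N ≤ T(N)` eventually**, for every `0 < ε < 1` and `δ > 0`, where
`T(N) = ∑_{n ≤ N} ∑_{d ∣ n²+1, d > ⌊N^{1-ε}⌋} μ(d) log d`: the lower wall for the large-divisor
Möbius–log sum, from `ψ ≤ (4𝔖 + o(1)) N` through the identity `ψ = 𝔖 N + E - T`, `E = o(N)`
(`sum_vonMangoldt_eq_main_sub_largeDivisorSum`, `eventually_abs_mainError_le`). With Tier 0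
(`eventually_largeDivisorSum_le`: `T ≤ (𝔖 + δ) N`) the unconditional window is
`-(3𝔖 + o(1)) N ≤ T(N) ≤ (𝔖 + o(1)) N` — asymmetric about `0`; Conjecture E is `T = o(N)`
(`hardyLittlewoodConjE_iff_largeDivisorSum_twoSided`), and any `T ≤ (𝔖 - c) N` infinitely often is
Landau's conjecture (`landauConjecture_of_frequently_largeDivisorSum_le`). -/
theorem eventually_neg_le_largeDivisorSum {ε : ℝ} (hε : 0 < ε) (hε1 : ε < 1) {δ : ℝ}
    (hδ : 0 < δ) :
    ∀ᶠ x : ℕ in atTop,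
      -((3 * hardyLittlewoodEConst + δ) * x) ≤
        ∑ n ∈ Icc 1 x, ∑ e ∈ (n ^ 2 + 1).divisors with ⌊(x : ℝ) ^ (1 - ε)⌋₊ < (n ^ 2 + 1) / e,
          (μ ((n ^ 2 + 1) / e) : ℝ) * Real.log (((n ^ 2 + 1) / e : ℕ) : ℝ) := by
  filter_upwards [eventually_sum_vonMangoldt_sq_add_one_le (half_pos hδ),
    eventually_abs_mainError_le hε hε1 (half_pos hδ)] with x hψ hE
  have hid := sum_vonMangoldt_eq_main_sub_largeDivisorSum x ε
  have := (abs_le.mp hE).1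
  linarith

/-- **The unconditional window, both walls at once**: for `0 < ε < 1` and `δ > 0`, eventually
`-(3𝔖 + δ) N ≤ T(N) ≤ (𝔖 + δ) N`. -/
theorem eventually_largeDivisorSum_mem_window {ε : ℝ} (hε : 0 < ε) (hε1 : ε < 1) {δ : ℝ}
    (hδ : 0 < δ) :
    ∀ᶠ x : ℕ in atTop,
      -((3 * hardyLittlewoodEConst + δ) * x) ≤
          ∑ n ∈ Icc 1 x, ∑ e ∈ (n ^ 2 + 1).divisors with ⌊(x : ℝ) ^ (1 - ε)⌋₊ < (n ^ 2 + 1) / e,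
            (μ ((n ^ 2 + 1) / e) : ℝ) * Real.log (((n ^ 2 + 1) / e : ℕ) : ℝ)
        ∧ ∑ n ∈ Icc 1 x, ∑ e ∈ (n ^ 2 + 1).divisors with ⌊(x : ℝ) ^ (1 - ε)⌋₊ < (n ^ 2 + 1) / e,
            (μ ((n ^ 2 + 1) / e) : ℝ) * Real.log (((n ^ 2 + 1) / e : ℕ) : ℝ)
          ≤ (hardyLittlewoodEConst + δ) * x :=
  (eventually_neg_le_largeDivisorSum hε hε1 hδ).and (eventually_largeDivisorSum_le hε hε1 hδ)

/-- **`T(N) = O(N)` unconditionally** — whereas Conjecture E is exactly `T(N) = o(N)`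
(`hardyLittlewoodConjE_iff_largeDivisorSum_isLittleO`): what is open is the constant, not the
order of magnitude (the prime divisors `p > N^{1-ε}` alone contribute `-(1 + ε + o(1)) N log N`
to `T`; the sieve bounds certify the cancellation of that logarithm against the divisors with an
even number of prime factors, and nothing beyond). -/
theorem largeDivisorSum_isBigO {ε : ℝ} (hε : 0 < ε) (hε1 : ε < 1) :
    (fun x : ℕ => ∑ n ∈ Icc 1 x,
        ∑ e ∈ (n ^ 2 + 1).divisors with ⌊(x : ℝ) ^ (1 - ε)⌋₊ < (n ^ 2 + 1) / e,
          (μ ((n ^ 2 + 1) / e) : ℝ) * Real.log (((n ^ 2 + 1) / e : ℕ) : ℝ))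
      =O[atTop] (fun x : ℕ => (x : ℝ)) := by
  refine IsBigO.of_bound (3 * hardyLittlewoodEConst + 1) ?_
  filter_upwards [eventually_largeDivisorSum_mem_window hε hε1 one_pos] with x hx
  rw [Real.norm_eq_abs, Real.norm_eq_abs, Nat.abs_cast, abs_le]
  have h2 : 0 ≤ hardyLittlewoodEConst * x := mul_nonneg hardyLittlewoodEConst_pos.le (Nat.cast_nonneg x)
  constructor <;> linarith [hx.1, hx.2]

end Summit.Parity.BatemanHorn.Theorems
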